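import Literature.NumberTheory.LFunctions.WeilExplicitArchTermProofs
import HarnessLib

/-!
# ξ absorbs the Weil distribution on the window — auxiliary file 1: the shifted digamma integral

Helper file for the stub `stub_xiAbsorption` of the line `causal-level-sets` for the crux
`WindowTraceArch` (stmt-RiemannHypothesis-11195; skeleton
`Summit.RiemannHypothesis.RiemannHypothesis.Cruxes.WindowTraceArch.CausalLevelSets`; the stub is
proved in `Theorems/SpectralTraceWindowTraceArchStubXiAbsorption.lean`).

For a Weil test `k` (`Literature.NumberTheory.LFunctions.IsWeilTest`) with transform
`k̂(s) = weilMellin k s` and a shift `h ≥ 0` we evaluate the digamma integral on the critical line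
with the digamma factor read on the shifted line `Re s = 1/2 + h`:
with `s = 1/2 + iy` and `w = s/2 + h/2 = (1/2 + h + iy)/2`,

* `xiAbs_hasSum_integral_digammaSeries` : `Σₙ ∫ k̂(s)(1/(n+1) − 1/(w+n)) dy = ∫ k̂(s)(ψ(w) + γ) dy`
  (the series `ψ(w) + γ = Σₙ (1/(n+1) − 1/(w+n))`, Andrews–Askey–Roy (1.2.13), integrated term by
  term by dominated convergence: the terms are `≤ 4‖w − 1‖‖k̂(s)‖/(n+1)²`);
* `xiAbs_integral_digammaSeriesTerm` : each term is a polar integral,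
  `∫ k̂(s)(1/(n+1) − 1/(w+n)) dy = 2π k(0)/(n+1) − 4π ∫₀^∞ k(x) e^{−(2n+h+1/2)x} dx`
  (`1/(w+n) = 2/(s + 2n + h)` and `∫ k̂(s)/(s − a) dy = 2π ∫₀^∞ k(x) e^{(a−1/2)x} dx`);
* `xiAbs_hasSum_digammaIntegral` (registered sub-goal) : the shifted digamma integral as a series,
  `Σₙ (2π k(0)/(n+1) − 4π ∫₀^∞ k(x) e^{−(2n+h+1/2)x} dx) = ∫ k̂(1/2+iy) ψ((1/2+h+iy)/2) dy + 2πγ k(0)`.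

This is the tree's computation `Literature/NumberTheory/LFunctions/WeilExplicitArchTermProofs.lean`
(E. Bombieri, Rend. Mat. Acc. Lincei (9) 11 (2000), §2, (2.5)–(2.7), the case `h = 0`) with the
digamma factor shifted by `h/2`; all ingredients are proved tree / Mathlib facts.
-/

set_option linter.dupNamespace false

noncomputable section

open Complex Set MeasureTheory Filter
open scoped Real Topology

namespace Summit.RiemannHypothesis.RiemannHypothesis.Theorems.SpectralTraceWindowTraceArch

open Literature.NumberTheory.LFunctions

variable {k : ℝ → ℂ} {h : ℝ}

/-- `Re((1/2 + iy)/2 + h/2) = 1/4 + h/2`. -/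
theorem xiAbs_re_w (h y : ℝ) :
    ((((1 / 2 : ℝ) : ℂ) + y * I) / 2 + (h : ℂ) / 2).re = 1 / 4 + h / 2 := by
  simp; norm_num

/-- For `h ≥ 0`: `(1/2 + iy)/2 + h/2 + n ≠ 0`. -/
theorem xiAbs_w_add_nat_ne_zero (hh : 0 ≤ h) (y : ℝ) (n : ℕ) :
    (((1 / 2 : ℝ) : ℂ) + y * I) / 2 + (h : ℂ) / 2 + n ≠ 0 := by
  intro h0
  have h1 := congrArg Complex.re h0
  rw [add_re, xiAbs_re_w] at h1
  simp at h1
  have hn : (0 : ℝ) ≤ n := n.cast_nonneg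
  linarith

/-- `‖(1/2 + iy)/2 + h/2 − 1‖ ≤ (1 + h)(1 + |y|)` for `h ≥ 0`. -/
theorem xiAbs_norm_w_sub_one_le (hh : 0 ≤ h) (y : ℝ) :
    ‖(((1 / 2 : ℝ) : ℂ) + y * I) / 2 + (h : ℂ) / 2 - 1‖ ≤ (1 + h) * (1 + |y|) := by
  have hre : ((((1 / 2 : ℝ) : ℂ) + y * I) / 2 + (h : ℂ) / 2 - 1).re = h / 2 - 3 / 4 := by
    rw [sub_re, xiAbs_re_w]; norm_num; ring
  have him : ((((1 / 2 : ℝ) : ℂ) + y * I) / 2 + (h : ℂ) / 2 - 1).im = y / 2 := by simp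
  refine (Complex.norm_le_abs_re_add_abs_im _).trans ?_
  rw [hre, him]
  have h1 : |h / 2 - 3 / 4| ≤ h / 2 + 3 / 4 := by
    rw [abs_le]; constructor <;> linarith
  have h2 : |y / 2| = |y| / 2 := by rw [abs_div, abs_two]
  rw [h2]
  nlinarith [abs_nonneg y]

/-- Integrability of `y ↦ k̂(1/2 + iy) ψ((1/2 + h + iy)/2)` for a test function `k` and `h ≥ 0`
(`|ψ| ≤ C + log(1 + |y|)` on the vertical line `Re w = 1/4 + h/2 > 0`). -/
theorem xiAbs_integrable_weilMellin_mul_digamma (hk : IsWeilTest k) (hh : 0 ≤ h) :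
    Integrable fun y : ℝ ↦ weilMellin k (((1 / 2 : ℝ) : ℂ) + y * I) *
      digamma ((((1 / 2 : ℝ) : ℂ) + y * I) / 2 + (h : ℂ) / 2) := by
  obtain ⟨C, hC⟩ := Literature.Analysis.SpecialFunctions.Complex.exists_norm_digamma_vertical_le
    (a := 1 / 4 + h / 2) (by positivity)
  have hcont : Continuous fun y : ℝ ↦ digamma ((((1 / 2 : ℝ) : ℂ) + y * I) / 2 + (h : ℂ) / 2) := by
    refine Literature.Analysis.SpecialFunctions.Complex.continuousOn_digamma.comp_continuous
      (by fun_prop) fun y ↦ ?_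
    simp only [mem_setOf_eq, xiAbs_re_w]
    positivity
  have hI := integrable_mul_weilMellin_vertical_of_norm_le_log hk (1 / 2) hcont (C := |C|)
    fun y ↦ ?_
  · refine hI.congr (Eventually.of_forall fun y ↦ ?_)
    ring
  · have hw : (((1 / 2 : ℝ) : ℂ) + y * I) / 2 + (h : ℂ) / 2 =
        ((1 / 4 + h / 2 : ℝ) : ℂ) + ((y / 2 : ℝ) : ℂ) * I := by
      push_cast; ring
    rw [hw]
    have h1 := hC (y / 2)
    have h2 : Real.log (1 + |y / 2|) ≤ Real.log (1 + |y|) := by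
      refine Real.log_le_log (by positivity) ?_
      rw [abs_div, abs_two]; linarith [abs_nonneg y]
    linarith [le_abs_self C]

/-- **Term-by-term integration of the shifted digamma series on the critical line**: for a test
function `k` and `h ≥ 0`, with `s = 1/2 + iy`, `w = s/2 + h/2`,
`Σₙ ∫ k̂(s)(1/(n+1) − 1/(w+n)) dy = ∫ k̂(s)(ψ(w) + γ) dy` (dominated convergence; the terms are
bounded by `4‖w − 1‖‖k̂(s)‖/(n+1)²` and `k̂` decays like `(1 + y²)⁻²`). -/
theorem xiAbs_hasSum_integral_digammaSeries (hk : IsWeilTest k) (hh : 0 ≤ h) :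
    HasSum (fun n : ℕ ↦ ∫ y : ℝ, weilMellin k (((1 / 2 : ℝ) : ℂ) + y * I) *
        (1 / ((n : ℂ) + 1) - 1 / ((((1 / 2 : ℝ) : ℂ) + y * I) / 2 + (h : ℂ) / 2 + n)))
      (∫ y : ℝ, weilMellin k (((1 / 2 : ℝ) : ℂ) + y * I) *
        (digamma ((((1 / 2 : ℝ) : ℂ) + y * I) / 2 + (h : ℂ) / 2) +
          Real.eulerMascheroniConstant)) := by
  have hw : ∀ y : ℝ, 0 < ((((1 / 2 : ℝ) : ℂ) + y * I) / 2 + (h : ℂ) / 2).re := fun y ↦ by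
    rw [xiAbs_re_w]; positivity
  have hw4 : ∀ y : ℝ, 1 / 4 ≤ min ((((1 / 2 : ℝ) : ℂ) + y * I) / 2 + (h : ℂ) / 2).re 1 := fun y ↦ by
    rw [xiAbs_re_w]; exact le_min (by linarith) (by norm_num)
  have hne := xiAbs_w_add_nat_ne_zero hh
  have hS : Summable fun n : ℕ ↦ 1 / ((n : ℝ) + 1) ^ 2 := by
    have h := (Real.summable_one_div_nat_pow.2 one_lt_two)
    exact_mod_cast (summable_nat_add_iff 1).2 h
  refine hasSum_integral_of_dominated_convergence
    (fun (n : ℕ) (y : ℝ) ↦ 4 * ‖(((1 / 2 : ℝ) : ℂ) + y * I) / 2 + (h : ℂ) / 2 - 1‖ *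
      ‖weilMellin k (((1 / 2 : ℝ) : ℂ) + y * I)‖ * (1 / ((n : ℝ) + 1) ^ 2))
    (fun n ↦ ?_) (fun n ↦ Eventually.of_forall fun y ↦ ?_) (Eventually.of_forall fun y ↦ ?_) ?_
    (Eventually.of_forall fun y ↦ ?_)
  · -- measurability
    exact ((continuous_weilMellin_vertical hk.1.continuous hk.2 _).mul
      (continuous_const.sub (continuous_const.div (by fun_prop) fun y ↦ hne y n))).aestronglyMeasurable
  · -- the bound
    rw [norm_mul]
    have h0 := Literature.Analysis.SpecialFunctions.Complex.norm_one_div_sub_one_div_le (hw y) n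
    have hk0 := norm_nonneg (weilMellin k (((1 / 2 : ℝ) : ℂ) + y * I))
    have hpos : (0 : ℝ) < ((n : ℝ) + 1) ^ 2 := by positivity
    have h1 : ‖1 / ((n : ℂ) + 1) - 1 / ((((1 / 2 : ℝ) : ℂ) + y * I) / 2 + (h : ℂ) / 2 + n)‖ ≤
        ‖(((1 / 2 : ℝ) : ℂ) + y * I) / 2 + (h : ℂ) / 2 - 1‖ / (1 / 4 * ((n : ℝ) + 1) ^ 2) :=
      h0.trans (div_le_div_of_nonneg_left (norm_nonneg _) (by positivity)
        (mul_le_mul_of_nonneg_right (hw4 y) hpos.le))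
    calc ‖weilMellin k (((1 / 2 : ℝ) : ℂ) + y * I)‖ *
          ‖1 / ((n : ℂ) + 1) - 1 / ((((1 / 2 : ℝ) : ℂ) + y * I) / 2 + (h : ℂ) / 2 + n)‖
        ≤ ‖weilMellin k (((1 / 2 : ℝ) : ℂ) + y * I)‖ *
          (‖(((1 / 2 : ℝ) : ℂ) + y * I) / 2 + (h : ℂ) / 2 - 1‖ / (1 / 4 * ((n : ℝ) + 1) ^ 2)) :=
          mul_le_mul_of_nonneg_left h1 hk0
      _ = 4 * ‖(((1 / 2 : ℝ) : ℂ) + y * I) / 2 + (h : ℂ) / 2 - 1‖ *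
          ‖weilMellin k (((1 / 2 : ℝ) : ℂ) + y * I)‖ * (1 / ((n : ℝ) + 1) ^ 2) := by
          field_simp
  · -- summability of the bound
    exact hS.mul_left _
  · -- integrability of the summed bound
    simp_rw [tsum_mul_left]
    refine Integrable.mul_const ?_ _
    have hF : Continuous fun y : ℝ ↦
        (4 : ℂ) * ((((1 / 2 : ℝ) : ℂ) + y * I) / 2 + (h : ℂ) / 2 - 1) := by fun_prop
    have hI := integrable_mul_weilMellin_vertical_of_norm_le_linear hk (1 / 2) hF
      (C := 4 * (1 + h)) fun y ↦ ?_
    · refine hI.norm.congr (Eventually.of_forall fun y ↦ ?_)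
      simp only [norm_mul]
      norm_num
    · rw [norm_mul]
      have h4 : ‖(4 : ℂ)‖ = 4 := by norm_num
      rw [h4, mul_assoc]
      exact mul_le_mul_of_nonneg_left (xiAbs_norm_w_sub_one_le hh y) (by norm_num)
  · -- pointwise: the series of Andrews–Askey–Roy (1.2.13)
    exact (Literature.Analysis.SpecialFunctions.Complex.hasSum_one_div_sub_one_div_digamma
      (hw y)).mul_left _

/-- **The terms are polar integrals**: for a test function `k`, `h ≥ 0` and `n ≥ 0`, with
`s = 1/2 + iy`, `w = s/2 + h/2`, `1/(w + n) = 2/(s + 2n + h)` and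
`∫ k̂(s)(1/(n+1) − 1/(w+n)) dy = 2π k(0)/(n+1) − 4π ∫₀^∞ k(x) e^{−(2n+h+1/2)x} dx`
(`∫ k̂ = 2π k(0)` and the polar integral `∫ k̂(s)/(s − a) dy = 2π ∫₀^∞ k(x)e^{(a−1/2)x} dx` with
`a = −(2n + h)`). -/
theorem xiAbs_integral_digammaSeriesTerm (hk : IsWeilTest k) (hh : 0 ≤ h) (n : ℕ) :
    ∫ y : ℝ, weilMellin k (((1 / 2 : ℝ) : ℂ) + y * I) *
        (1 / ((n : ℂ) + 1) - 1 / ((((1 / 2 : ℝ) : ℂ) + y * I) / 2 + (h : ℂ) / 2 + n)) =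
      2 * π * k 0 / ((n : ℂ) + 1) -
        4 * π * ∫ x in Ioi (0 : ℝ), k x * cexp ((-(2 * (n : ℂ)) - h - 1 / 2) * x) := by
  have h1 : Integrable fun y : ℝ ↦ weilMellin k (((1 / 2 : ℝ) : ℂ) + y * I) :=
    integrable_weilMellin_vertical hk _
  have hre : (-(2 * (n : ℂ) + h)).re < (1 / 2 : ℝ) := by
    have hn : (0 : ℝ) ≤ n := n.cast_nonneg
    simp; linarith
  have h2 := integral_weilMellin_vertical_div_sub hk (c := 1 / 2) (a := -(2 * (n : ℂ) + h)) hre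
  have h2i := integrable_weilMellin_vertical_div_sub hk (c := 1 / 2) (a := -(2 * (n : ℂ) + h)) hre.ne
  have e : ∀ y : ℝ, weilMellin k (((1 / 2 : ℝ) : ℂ) + y * I) *
      (1 / ((n : ℂ) + 1) - 1 / ((((1 / 2 : ℝ) : ℂ) + y * I) / 2 + (h : ℂ) / 2 + n)) =
      1 / ((n : ℂ) + 1) * weilMellin k (((1 / 2 : ℝ) : ℂ) + y * I) -
        2 * (weilMellin k (((1 / 2 : ℝ) : ℂ) + y * I) /
          (((1 / 2 : ℝ) : ℂ) + y * I - -(2 * (n : ℂ) + h))) := by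
    intro y
    have hne : (((1 / 2 : ℝ) : ℂ) + y * I) / 2 + (h : ℂ) / 2 + n ≠ 0 := xiAbs_w_add_nat_ne_zero hh y n
    have hne' : ((1 / 2 : ℝ) : ℂ) + y * I - -(2 * (n : ℂ) + h) ≠ 0 := by
      intro h0
      have h1 := congrArg Complex.re h0
      simp at h1
      have hn : (0 : ℝ) ≤ n := n.cast_nonneg
      linarith
    have key : 1 / ((((1 / 2 : ℝ) : ℂ) + y * I) / 2 + (h : ℂ) / 2 + n) =
        2 / (((1 / 2 : ℝ) : ℂ) + y * I - -(2 * (n : ℂ) + h)) := by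
      rw [div_eq_div_iff hne hne']
      ring
    rw [key]
    ring
  simp_rw [e]
  rw [integral_sub (h1.const_mul _) (h2i.const_mul 2), integral_const_mul, integral_const_mul,
    integral_weilMellin_vertical hk, h2]
  have e2 : (fun x : ℝ ↦ k x * cexp ((-(2 * (n : ℂ) + h) - 1 / 2) * x)) =
      fun x : ℝ ↦ k x * cexp ((-(2 * (n : ℂ)) - h - 1 / 2) * x) := by
    funext x; ring_nf
  rw [e2]
  ring

/-- **The shifted digamma integral as a series** (registered sub-goal of `stub_xiAbsorption`): for
a Weil test `k` and `h ≥ 0`,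
`Σₙ (2π k(0)/(n+1) − 4π ∫₀^∞ k(x) e^{−(2n+h+1/2)x} dx) = ∫ k̂(1/2+iy) ψ((1/2+iy)/2 + h/2) dy + 2πγ k(0)`
(Bombieri 2000, §2, (2.5)–(2.7) with the digamma factor shifted by `h/2`). -/
theorem xiAbs_hasSum_digammaIntegral :
    ∀ (k : ℝ → ℂ) (h : ℝ), IsWeilTest k → 0 ≤ h →
      HasSum (fun n : ℕ => 2 * π * k 0 / ((n : ℂ) + 1) -
          4 * π * ∫ x in Ioi (0 : ℝ), k x * cexp ((-(2 * (n : ℂ)) - h - 1 / 2) * x))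
        ((∫ y : ℝ, weilMellin k (((1 / 2 : ℝ) : ℂ) + y * I) *
            digamma ((((1 / 2 : ℝ) : ℂ) + y * I) / 2 + (h : ℂ) / 2)) +
          2 * π * Real.eulerMascheroniConstant * k 0) := by
  intro k h hk hh
  have hIψ := xiAbs_integrable_weilMellin_mul_digamma hk hh
  have hI1 : Integrable fun y : ℝ ↦ weilMellin k (((1 / 2 : ℝ) : ℂ) + y * I) :=
    integrable_weilMellin_vertical hk _
  have hsplit : (∫ y : ℝ, weilMellin k (((1 / 2 : ℝ) : ℂ) + y * I) *
      (digamma ((((1 / 2 : ℝ) : ℂ) + y * I) / 2 + (h : ℂ) / 2) + Real.eulerMascheroniConstant)) =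
      (∫ y : ℝ, weilMellin k (((1 / 2 : ℝ) : ℂ) + y * I) *
          digamma ((((1 / 2 : ℝ) : ℂ) + y * I) / 2 + (h : ℂ) / 2)) +
        2 * π * Real.eulerMascheroniConstant * k 0 := by
    have e : (fun y : ℝ ↦ weilMellin k (((1 / 2 : ℝ) : ℂ) + y * I) *
        (digamma ((((1 / 2 : ℝ) : ℂ) + y * I) / 2 + (h : ℂ) / 2) + Real.eulerMascheroniConstant)) =
        fun y : ℝ ↦ weilMellin k (((1 / 2 : ℝ) : ℂ) + y * I) *
          digamma ((((1 / 2 : ℝ) : ℂ) + y * I) / 2 + (h : ℂ) / 2) +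
          weilMellin k (((1 / 2 : ℝ) : ℂ) + y * I) * Real.eulerMascheroniConstant := by
      funext y; ring
    rw [e, integral_add hIψ (hI1.mul_const _), integral_mul_const, integral_weilMellin_vertical hk]
    ring
  have hA := xiAbs_hasSum_integral_digammaSeries hk hh
  simp_rw [xiAbs_integral_digammaSeriesTerm hk hh] at hA
  rwa [hsplit] at hA

end Summit.RiemannHypothesis.RiemannHypothesis.Theorems.SpectralTraceWindowTraceArch

end
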